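import Summits.BirchSwinnertonDyer.BirchSwinnertonDyer.Theorems.K4Neg.Negative.K4NegFalseOfGenusLedgerPFrame
import HarnessLib

/-!
# K₄⁻ `K4Neg` (stmt-BirchSwinnertonDyer-31526) — the LOGICAL SHAPE of the hypothesis `H = GenusLedgerPFrameAtTwo` of the negative
# lemma `k4Neg_false_of_genusLedgerPFrame` (REF1 §400 finding F400 / rider R400b)

Seat `bsd-line-gk2-p3` g37 (PROVER seat 3/3, cell `bsd-f1-sign2`), `--supports stmt-BirchSwinnertonDyer-31526 --as helper`; companion of
this lineage's `Theorems/K4Neg/Negative/K4NegFalseOfGenusLedgerPFrame.lean` (gk2-p3 g36: p796083, p796377, p796555), written at the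
request of the cell's statement/binder refuter (REF1 g32, `REF1-AUDIT-v1.md` §400, kernel probes `REF1-data/b400/K4NegProbe400.lean`,
whose K400.1/K400.2 are re-landed here VERBATIM in shape, with the right-hand sides spelled out instead of a new predicate).
Kept in its own module because the Negative/ file is at the 400-line cap.  **Nothing about BSD or `K4Neg` changes: K4Neg stays
open/aside, neither proved nor refuted; BSD is NOT proved or disproved for any curve; nothing is closed.**

## What is recorded

REF1's binder audit of the Negative/ file (cell bsd-f1-sign2, `REF1-AUDIT-v1.md` §400, probes `REF1-data/b400/K4NegProbe400.lean`)
observes that, GIVEN the tree (gk2-p3 g35's phantom persistence p794583, through its ★ `two_dvd_derivedPoint_of_isGenusLedgerPFrame`),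
the GENUS-LEDGER block of `H` is NOT an independent BSD-grade law inside the kernel: on a loc₂-silent phantom 𝒫-frame it is EQUIVALENT
to «no admissible square-free level carries a `2`-primitive derived point» — (→) is ★, (←) is vacuous truth (the ledger is an
implication whose antecedent `P_d(n) ∉ 2E(K[n])` then never fires).  Hence `H = GenusLedgerPFrameAtTwo` reads honestly as «SOME loc₂-silent phantom 𝒫-frame of `K4Neg` carries NO `2`-primitive
admissible derived point» — a POINTED counterexample to `K4Neg` on the phantom cell — and the BSD₂ ⊗ explicit-Gross–Zagier ⊗ Milne ⊗
`c_λ = 4` content of the memo's (★) lives entirely in the UNTYPED road that would prove that right-hand side on EVERY such frame (rider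
R400a: re-key the auto-filed construction item as H∃ «a loc₂-silent phantom 𝒫-frame exists» + H∀ «on every such frame every admissible
derived point is `2`-divisible»).  The two equivalences are recorded here, next to the Negative/ file; no new predicate is
introduced (the right-hand sides are spelled out).

References: [GrossLMS1991] §3 (3.1)–(3.3), §5 (5.1); [LawsonWuthrich2016] §7.1; [WZhang2014] Notations (xii).
-/

set_option autoImplicit false
-- the Theorems namespace of this sub repeats the summit name by design (D-0017 nested layout: Summit.<S>.<Sub>)
set_option linter.dupNamespace false

noncomputable section

open scoped Classical NumberField

namespace Summit.BirchSwinnertonDyer.BirchSwinnertonDyer.Theorems.K4NegNegative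

open WeierstrassCurve Field NumberField IsDedekindDomain
open Literature.NumberTheory.EllipticCurves Literature.NumberTheory.EllipticCurves.ModularForms
open Literature.NumberTheory.GaloisRepresentations

/-- **On a loc₂-silent phantom 𝒫-frame, the genus ledger IS «every admissible derived point is `2`-divisible»** (REF1 §400 K400.1):
`GenusLedgerAt W K ℓ₀ Dt β ι ⟺` for every square-free `n` of Zhang–Kolyvagin primes at `2` of index `≥ 2` with `Frob_ℓ = Frob_∞` and
every conductor-`n` datum `d`, `P_d(n) ∈ 2E(K[n])`.  (→) = ★ `two_dvd_derivedPoint_of_isGenusLedgerPFrame` through `isGenusLedgerPFrame_iff`; (←) = vacuous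
truth of the ledger's implication.  So, modulo the tree, the ledger hypothesis carries no arithmetic beyond p794583. [folklore] -/
theorem genusLedgerAt_iff_forall_two_dvd_derivedPoint {W : WeierstrassCurve ℚ} [W.IsElliptic] [W.IsGloballyMinimal]
    [NeZero (W.conductorNorm ℤ)] {K : Type} [Field K] [NumberField K] {ℓ₀ : ℕ}
    {Dt : ModularParametrizationData W (W.conductorNorm ℤ)} {β : ℤ} {ι : K →+* ℂ} {d₁ : KolyvaginHeegnerData Dt β ι 1} {M₀ : ℕ}
    {Wd : WeierstrassCurve ℚ} {ξ : galH1Torsion W (2 : ℤ)}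
    (hP : IsLocTwoSilentPhantomPFrame W K ℓ₀ Dt β ι d₁ M₀ Wd ξ) :
    GenusLedgerAt W K ℓ₀ Dt β ι ↔
      ∀ (n : ℕ) (d : KolyvaginHeegnerData Dt β ι n), Squarefree n →
        (∀ ℓ ∈ n.primeFactors, Zhang2014.IsKolyvaginPrime (W.conductorNorm ℤ) W K 2 ℓ ∧
          2 ≤ Zhang2014.kolyvaginIndex W 2 ℓ ∧ FrobEqFrobInfty W K 2 ℓ) →
        ∃ Q : (W.baseChange (ringClassField K ι n)).toAffine.Point, (2 : ℤ) • Q = d.derivedPoint := by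
  constructor
  · intro hL n d hsq hprimes
    exact two_dvd_derivedPoint_of_isGenusLedgerPFrame (isGenusLedgerPFrame_iff.mpr ⟨hP, hL⟩) d hsq hprimes
  · intro hN n d hsq hprimes hprim
    exact absurd (hN n d hsq hprimes) hprim

/-- **`H` re-read** (REF1 §400 K400.2): `GenusLedgerPFrameAtTwo` ⟺ «SOME loc₂-silent phantom 𝒫-frame of `K4Neg` exists on which EVERY
admissible derived point is `2`-divisible» — the honest name of the construction item auto-filed by the `--negative-modulo` booking (a pointed
`K4Neg`-counterexample on the phantom cell: H∃ ∧ H∀-at-that-frame, rider R400a), not a BSD₂-type input.  Pure logic over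
`genusLedgerAt_iff_forall_two_dvd_derivedPoint`. [folklore] -/
theorem genusLedgerPFrameAtTwo_iff_exists_phantomPFrame_forall_two_dvd :
    GenusLedgerPFrameAtTwo ↔
      ∃ (W : WeierstrassCurve ℚ) (_ : W.IsElliptic) (_ : W.IsGloballyMinimal) (_ : NeZero (W.conductorNorm ℤ))
        (K : Type) (_ : Field K) (_ : NumberField K) (ℓ₀ : ℕ)
        (Dt : ModularParametrizationData W (W.conductorNorm ℤ)) (β : ℤ) (ι : K →+* ℂ) (d₁ : KolyvaginHeegnerData Dt β ι 1) (M₀ : ℕ)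
        (Wd : WeierstrassCurve ℚ) (_ : Wd.IsElliptic) (_ : Wd.IsGloballyMinimal) (ξ : galH1Torsion W (2 : ℤ)),
        IsLocTwoSilentPhantomPFrame W K ℓ₀ Dt β ι d₁ M₀ Wd ξ ∧
          ∀ (n : ℕ) (d : KolyvaginHeegnerData Dt β ι n), Squarefree n →
            (∀ ℓ ∈ n.primeFactors, Zhang2014.IsKolyvaginPrime (W.conductorNorm ℤ) W K 2 ℓ ∧
              2 ≤ Zhang2014.kolyvaginIndex W 2 ℓ ∧ FrobEqFrobInfty W K 2 ℓ) →
            ∃ Q : (W.baseChange (ringClassField K ι n)).toAffine.Point, (2 : ℤ) • Q = d.derivedPoint := by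
  constructor
  · rintro ⟨W, _, _, _, K, _, _, ℓ₀, Dt, β, ι, d₁, M₀, Wd, _, _, ξ, hF⟩
    obtain ⟨hP, hL⟩ := isGenusLedgerPFrame_iff.mp hF
    exact ⟨W, ‹_›, ‹_›, ‹_›, K, ‹_›, ‹_›, ℓ₀, Dt, β, ι, d₁, M₀, Wd, ‹_›, ‹_›, ξ, hP,
      (genusLedgerAt_iff_forall_two_dvd_derivedPoint hP).mp hL⟩
  · rintro ⟨W, _, _, _, K, _, _, ℓ₀, Dt, β, ι, d₁, M₀, Wd, _, _, ξ, hP, hN⟩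
    exact ⟨W, ‹_›, ‹_›, ‹_›, K, ‹_›, ‹_›, ℓ₀, Dt, β, ι, d₁, M₀, Wd, ‹_›, ‹_›, ξ,
      isGenusLedgerPFrame_iff.mpr ⟨hP, (genusLedgerAt_iff_forall_two_dvd_derivedPoint hP).mpr hN⟩⟩

end Summit.BirchSwinnertonDyer.BirchSwinnertonDyer.Theorems.K4NegNegative

end
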